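import Summits.AnomalousDissipation.AnomalousDissipation.Theorems.SolenoidalFractalHomogenisationLagrangianStepBandKillSmallL
import Summits.AnomalousDissipation.AnomalousDissipation.Theorems.SolenoidalFractalHomogenisationLagrangianStepBandKillLargeL
import HarnessLib

/-!
# W3-E (ii) of the one-level design: `stub_effectiveFrameEnergyL_bandKill` DISCHARGED BY NAME
# (registered stub of K1L_D `stmt-AnomalousDissipation-27980`, registry v18/v19 of the one-level design line)

Summits-side file (everything proved; no definitions, no named facts).  The band-kill clauses (ii-out)/(ii-in) of the effective-frame
energy law for the Lagrangian lattice carrier, for `T ∈ {Um s s′, (Um s s′)†}` and all frequency levels `2L' ≤ L`, with constants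
`C₂ ≥ 1`, `θ₁ > 0`, `c₃ > 0` chosen before the carrier: the short-separation branch `L < 2000` is `bandKill_smallL` (dissipation floor +
low-mode capture, p702093), the long-separation branch `L ≥ 2000` on a genuine window is `bandKill_largeL` (cube ladder: F2′/F2c′
approximate-locality band kill with the analytic cube tail of the coarse Lagrangian field, p703792), and the degenerate window `s = s′` is
`bandKill_of_window_eq` (`Um s s = P_σ`).  The statement is VERBATIM the registered stub signature. Infrastructure for route-1's rung leaf
F-D1.A0 (a frontier FORMAL rung); NOT a proof of K1L_D or of anomalous dissipation.
-/

set_option linter.dupNamespace false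

namespace Summit.AnomalousDissipation.AnomalousDissipation.Theorems.SolenoidalFractalHomogenisation.LagrangianStep

open Literature.Analysis Literature.Analysis.FluidPDE Literature.Analysis.FunctionSpaces
open MeasureTheory Set Filter Function
open scoped ENNReal NNReal InnerProductSpace
open Literature.Analysis.FluidPDE.LatticeShear

noncomputable section

/-- **W3-E (ii) `stub_effectiveFrameEnergyL_bandKill`** (registered stub of the one-level design line for K1L_D, VERBATIM signature):
for every design word, stretch, gain, viscosity frame map and ellipticity window there are `C₂ ≥ 1`, `θ₁ > 0`, `c₃ > 0` such that for every
`L`-permissible regular Lagrangian lattice carrier of that design under the strain ceiling `θ₁`, every level `m`, every admissible cell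
tensor, every propagator `Um` of the coarse field `b_{≤m}` on `[0,1]`, every window `s ≤ s′` of length `≤ 2·refresh(m+1)` and
`T ∈ {Um s s′, (Um s s′)†}`: (ii-out) `‖T y − Q_L T y‖ ≤ e^{−ϱ/2}‖y − Q_{L'} y‖ + ℓ‖y‖` and (ii-in) `Q_L y = 0 ⇒ ‖T y‖ ≤ (e^{−ϱ/2} + ℓ)‖y‖`
for all `2L' ≤ L`, with the rate `ϱ = a_{m+1}·8π²L'²lo(ν + c/ν)(s′−s)/N_{m+1}²` and the leak `ℓ = e^{−c₃/θ_{m+1}} + e^{−(L−L')/(C₂N_m)}`. -/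
theorem stub_effectiveFrameEnergyL_bandKill : ∀ k (W : Literature.Analysis.FluidPDE.LatticeShear.LatticeWord k) (M : ℝ) (hM : 0 < M) (c : ℝ), 0 < c →
    ∀ (Φ : ℝ → Torus.Visc4 (Fin 3) → Torus.Visc4 (Fin 3)) (lo hi β : ℝ), 0 < lo → lo ≤ 1 → 1 ≤ hi → 0 ≤ β →
      ∃ C₂ : ℝ, 1 ≤ C₂ ∧ ∃ θ₁ > (0:ℝ), ∃ c₃ > (0:ℝ),
        ∀ E : Literature.Analysis.FluidPDE.LatticeShear.LagrangianLatticeCarrier k, E.design = W.stretch M hM → E.gain = c →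
          E.LPermissible → E.Regular → (∀ i, E.θ (i + 1) ≤ θ₁) → (∀ m, E.N m ^ 2 ≤ E.N (m + 1)) →
        ∀ (m : ℕ),
        ∀ (S : Torus.Visc4 (Fin 3)), Torus.OddSmall S β → Torus.NearIso S lo hi →
          Torus.OddSmall (Φ (E.cellVisc (m + 1)) S) β → Torus.NearIso (Φ (E.cellVisc (m + 1)) S) lo hi →
        ∀ Um : ℝ → ℝ → (V2 →L[ℝ] V2),
          Torus.IsPropagator 1 (E.partialSum m) (E.kbar m • renormStep (Φ (E.cellVisc (m + 1))) (E.gain / E.cellVisc (m + 1) ^ 2) S) Um →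
        ∀ (s s' : ℝ), 0 ≤ s → s ≤ s' → s' ≤ 1 → s' - s ≤ 2 * E.refresh (m + 1) →
        ∀ T : V2 →L[ℝ] V2, (T = Um s s' ∨ T = ContinuousLinearMap.adjoint (Um s s')) →
          -- (ii-out) band kill, output form (NORM form, factor gap), ENGINE-A currency: one factor-2 climb costs `e^(−c₃/θ(m+1))` (thin geometric
          -- bands, p4 21:08:07Z) and the additive-hop branch `e^(−(L−L')/(C₂ N_m))`
          (∀ L' L : ℕ, 2 * L' ≤ L → ∀ y : V2,
              ‖T y - cutLp L (T y)‖
                ≤ Real.exp (-(E.a (m + 1) * (8 * Real.pi ^ 2 * (L' : ℝ) ^ 2 * lo * (E.cellVisc (m + 1) + c / E.cellVisc (m + 1))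
                    / (E.N (m + 1) : ℝ) ^ 2) * (s' - s) / 2)) * ‖y - cutLp L' y‖
                  + (Real.exp (-(c₃ / E.θ (m + 1))) + Real.exp (-(((L : ℝ) - L') / (C₂ * E.N m)))) * ‖y‖) ∧
          -- (ii-in) band kill, input form (NORM form, factor gap), engine-A currency
          (∀ L' L : ℕ, 2 * L' ≤ L → ∀ y : V2, cutLp L y = 0 →
              ‖T y‖
                ≤ (Real.exp (-(E.a (m + 1) * (8 * Real.pi ^ 2 * (L' : ℝ) ^ 2 * lo * (E.cellVisc (m + 1) + c / E.cellVisc (m + 1))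
                    / (E.N (m + 1) : ℝ) ^ 2) * (s' - s) / 2))
                  + (Real.exp (-(c₃ / E.θ (m + 1))) + Real.exp (-(((L : ℝ) - L') / (C₂ * E.N m))))) * ‖y‖) := by
  intro k W M hM c hc Φ lo hi β hlo hlo1 hhi hβ
  obtain ⟨θS, hθS, hSmall⟩ := bandKill_smallL k W M hM c hc Φ lo hi β hlo hlo1 hhi hβ
  obtain ⟨C₂, hC₂, θL, hθL, c₃, hc₃, hLarge⟩ := bandKill_largeL k W M hM c hc Φ lo hi β hlo hlo1 hhi hβ
  refine ⟨C₂, by linarith, min θS θL, lt_min hθS hθL, c₃, hc₃, ?_⟩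
  intro E hdes hgain hLP hReg hθ hsq m S hS₁ hS₂ hS₃ hS₄ Um hUm s s' hs hss' hs'1 hlen T hT
  have hθS' : ∀ i, E.θ (i + 1) ≤ θS := fun i => (hθ i).trans (min_le_left _ _)
  have hθL' : ∀ i, E.θ (i + 1) ≤ θL := fun i => (hθ i).trans (min_le_right _ _)
  have H : ∀ L' L : ℕ, 2 * L' ≤ L →
      (∀ y : V2, ‖T y - cutLp L (T y)‖
          ≤ Real.exp (-(E.a (m + 1) * (8 * Real.pi ^ 2 * (L' : ℝ) ^ 2 * lo * (E.cellVisc (m + 1) + c / E.cellVisc (m + 1))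
              / (E.N (m + 1) : ℝ) ^ 2) * (s' - s) / 2)) * ‖y - cutLp L' y‖
            + (Real.exp (-(c₃ / E.θ (m + 1))) + Real.exp (-(((L : ℝ) - L') / (C₂ * E.N m)))) * ‖y‖) ∧
      (∀ y : V2, cutLp L y = 0 → ‖T y‖
          ≤ (Real.exp (-(E.a (m + 1) * (8 * Real.pi ^ 2 * (L' : ℝ) ^ 2 * lo * (E.cellVisc (m + 1) + c / E.cellVisc (m + 1))
              / (E.N (m + 1) : ℝ) ^ 2) * (s' - s) / 2))
            + (Real.exp (-(c₃ / E.θ (m + 1))) + Real.exp (-(((L : ℝ) - L') / (C₂ * E.N m))))) * ‖y‖) := by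
    intro L' L hL
    by_cases hLs : L < 2000
    · exact hSmall E hdes hgain hLP hReg hθS' hsq m S hS₁ hS₂ hS₃ hS₄ Um hUm s s' hs hss' hs'1 hlen T hT C₂ c₃ hC₂ L' L hL hLs
    · rcases hss'.eq_or_lt with hEq | hlt
      · -- the degenerate window: `Um s s = P_σ`
        subst hEq
        have hℓ : 0 ≤ Real.exp (-(c₃ / E.θ (m + 1))) + Real.exp (-(((L : ℝ) - L') / (C₂ * E.N m))) := by positivity
        have h := bandKill_of_window_eq hUm hs hs'1 T hT (show L' ≤ L by omega) hℓ
        have he : Real.exp (-(E.a (m + 1) * (8 * Real.pi ^ 2 * (L' : ℝ) ^ 2 * lo * (E.cellVisc (m + 1) + c / E.cellVisc (m + 1))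
            / (E.N (m + 1) : ℝ) ^ 2) * (s - s) / 2)) = 1 := by
          rw [sub_self, mul_zero, zero_div, neg_zero, Real.exp_zero]
        rw [he]; exact h
      · exact hLarge E hdes hgain hLP hReg hθL' hsq m S hS₁ hS₂ hS₃ hS₄ Um hUm s s' hs hlt hs'1 hlen T hT L' L hL (by omega)
  exact ⟨fun L' L hL => (H L' L hL).1, fun L' L hL => (H L' L hL).2⟩

/-- **Clause (ii-in) alone** (the input-form band kill, for consumers that only climb the frequency ladder): same binders and the same
constants `C₂, θ₁, c₃` as `stub_effectiveFrameEnergyL_bandKill`; `Q_L y = 0 ⇒ ‖T y‖ ≤ (e^{−ϱ/2} + ℓ)‖y‖` for all `2L' ≤ L`. -/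
theorem effectiveFrameEnergyL_bandKill_in : ∀ k (W : Literature.Analysis.FluidPDE.LatticeShear.LatticeWord k) (M : ℝ) (hM : 0 < M)
    (c : ℝ), 0 < c →
    ∀ (Φ : ℝ → Torus.Visc4 (Fin 3) → Torus.Visc4 (Fin 3)) (lo hi β : ℝ), 0 < lo → lo ≤ 1 → 1 ≤ hi → 0 ≤ β →
      ∃ C₂ : ℝ, 1 ≤ C₂ ∧ ∃ θ₁ > (0:ℝ), ∃ c₃ > (0:ℝ),
        ∀ E : Literature.Analysis.FluidPDE.LatticeShear.LagrangianLatticeCarrier k, E.design = W.stretch M hM → E.gain = c →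
          E.LPermissible → E.Regular → (∀ i, E.θ (i + 1) ≤ θ₁) → (∀ m, E.N m ^ 2 ≤ E.N (m + 1)) →
        ∀ (m : ℕ),
        ∀ (S : Torus.Visc4 (Fin 3)), Torus.OddSmall S β → Torus.NearIso S lo hi →
          Torus.OddSmall (Φ (E.cellVisc (m + 1)) S) β → Torus.NearIso (Φ (E.cellVisc (m + 1)) S) lo hi →
        ∀ Um : ℝ → ℝ → (V2 →L[ℝ] V2),
          Torus.IsPropagator 1 (E.partialSum m) (E.kbar m • renormStep (Φ (E.cellVisc (m + 1))) (E.gain / E.cellVisc (m + 1) ^ 2) S) Um →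
        ∀ (s s' : ℝ), 0 ≤ s → s ≤ s' → s' ≤ 1 → s' - s ≤ 2 * E.refresh (m + 1) →
        ∀ T : V2 →L[ℝ] V2, (T = Um s s' ∨ T = ContinuousLinearMap.adjoint (Um s s')) →
        ∀ L' L : ℕ, 2 * L' ≤ L → ∀ y : V2, cutLp L y = 0 →
          ‖T y‖ ≤ (Real.exp (-(E.a (m + 1) * (8 * Real.pi ^ 2 * (L' : ℝ) ^ 2 * lo * (E.cellVisc (m + 1) + c / E.cellVisc (m + 1))
              / (E.N (m + 1) : ℝ) ^ 2) * (s' - s) / 2))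
            + (Real.exp (-(c₃ / E.θ (m + 1))) + Real.exp (-(((L : ℝ) - L') / (C₂ * E.N m))))) * ‖y‖ := by
  intro k W M hM c hc Φ lo hi β hlo hlo1 hhi hβ
  obtain ⟨C₂, hC₂, θ₁, hθ₁, c₃, hc₃, h⟩ := stub_effectiveFrameEnergyL_bandKill k W M hM c hc Φ lo hi β hlo hlo1 hhi hβ
  refine ⟨C₂, hC₂, θ₁, hθ₁, c₃, hc₃, ?_⟩
  intro E hdes hgain hLP hReg hθ hsq m S hS₁ hS₂ hS₃ hS₄ Um hUm s s' hs hss' hs'1 hlen T hT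
  exact (h E hdes hgain hLP hReg hθ hsq m S hS₁ hS₂ hS₃ hS₄ Um hUm s s' hs hss' hs'1 hlen T hT).2

end

end Summit.AnomalousDissipation.AnomalousDissipation.Theorems.SolenoidalFractalHomogenisation.LagrangianStep
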